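import Summits.QuantumFields.YangMills.Theorems.BalabanLadderUVSeamRecFloorsEngineOfWeakWindow
import Literature.MathematicalPhysics.QuantumLattice.RepLieAlgebraUnitary
import HarnessLib

/-!
# Crux `UVSeamRec` (stmt-QuantumFields-20043): CHECK-LEMMA — the registered v4-F `stub_floorsEngine` from FLOOR-PACKAGE window data at `rF`

Helper file of the fleet lead prover of crux `NT` (unit `ym-spine-19353-p1`, g2).  The skeleton of record of the seam
crux (`Cruxes/UVSeamRec/Lines/birth.lean`, v4-F f523973980851859) fixes the FUNDAMENTAL lattice representation
`rF := fundamentalLatticeRep 2` of `SU(2)` and asks, in `stub_floorsEngine`, for a unit map `a > 0` with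
`a β / uRec β → c₀ > 0` carrying compactly supported `Q2` / `|Q3|` floor witnesses at `rF`.  This file states the femto
discharge of that stub in the v4-F shape from the FLOOR package of crux `NT` (its skeleton v3 minus the clause (A),
which `BoundaryLaw.abs_of_fbl` derives from `FBL`):

* `stubFloorsEngine_of_floorWindow_rF` — `SU(2)`, Borel σ-algebra: a unit `a > 0` window-commensurate with `uRec`
  (`c₁ ≤ a β / uRec β ≤ c₂` eventually, `0 < c₁ ≤ c₂`) carrying `FBL`, the forward-cone conditional two-point floor (F)
  and the weak signed third-cumulant clause (T) AT `rF` ⇒ THE REGISTERED `stub_floorsEngine` STATEMENT (with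
  `Transport.uRec`, definitionally the skeleton's `uRec`), witnesses `(c₂ · uRec, c₀ := c₂)`.  `a → 0` is derived from the
  window (`FloorsEngineOfWindow.tendsto_zero_of_window`).
-/

set_option autoImplicit false

noncomputable section

open scoped SchwartzMap
open MeasureTheory Filter Topology
open Literature.MathematicalPhysics.QuantumFieldTheory Literature.MathematicalPhysics.QuantumLattice
open Summit.QuantumFields.YangMills.Cruxes.OSLegsFromFemtoAndGap.DlrCollarTransfer

namespace Summit.QuantumFields.YangMills.Cruxes.UVSeamRec.WeakWindow

/-- **CHECK-LEMMA: the REGISTERED v4-F `stub_floorsEngine` statement from floor-package window data at `rF`.**  For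
`SU(2)` with its Borel σ-algebra: if some unit map `a > 0` with `c₁ ≤ a β / uRec β ≤ c₂` eventually (`0 < c₁ ≤ c₂`)
carries, at the fundamental lattice representation `fundamentalLatticeRep 2`, the femto boundary law `FBL`, the weak
floor clause (F) and the weak third-cumulant clause (T) of crux `NT`'s package, then the statement of the registered stub
`stub_floorsEngine` (v4-F) holds verbatim, with witnesses `(c₂ · uRec, c₀ := c₂)`. [folklore] -/
theorem stubFloorsEngine_of_floorWindow_rF
    (h : letI : MeasurableSpace (Matrix.specialUnitaryGroup (Fin 2) ℂ) := borel _
      haveI : BorelSpace (Matrix.specialUnitaryGroup (Fin 2) ℂ) := ⟨rfl⟩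
      ∃ (a : ℝ → ℝ) (c₁ c₂ : ℝ), 0 < c₁ ∧ c₁ ≤ c₂ ∧ (∀ β, 0 < a β) ∧
        (∀ᶠ β in atTop, c₁ ≤ a β / Transport.uRec β ∧ a β / Transport.uRec β ≤ c₂) ∧
        FBL (Matrix.specialUnitaryGroup (Fin 2) ℂ) (fundamentalLatticeRep 2) a ∧
        (∃ (Γ : ℝ → ℝ) (β₂ ℓ₂ c₂ : ℝ) (K : ℝ → ℝ) (n₀ : ℕ), 0 < ℓ₂ ∧ 0 < c₂ ∧ (∀ s, 1 ≤ K s) ∧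
      Tendsto (fun s : ℝ => s * K s) (nhdsWithin 0 (Set.Ioi 0)) (nhds 0) ∧ 1 ≤ n₀ ∧
      Tendsto (fun s : ℝ => Γ s / s ^ 8) (nhdsWithin 0 (Set.Ioi 0)) atTop ∧
      ∀ β : ℝ, β₂ ≤ β → ∀ (x : Fin 4 → ℤ) (R : ℕ), ((2 * R + 1 : ℕ) : ℝ) * a β ≤ ℓ₂ →
        ∀ (η : LGConfig 4 (Matrix.specialUnitaryGroup (Fin 2) ℂ)) (y : Fin 4 → ℤ) (s₀ : ℝ), 0 < s₀ → s₀ ≤ ‖siteToE (y - x)‖ * a β →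
          (n₀ : ℝ) ≤ ‖siteToE (y - x)‖ → ‖siteToE (y - x)‖ < 3 * siteToE (y - x) 0 →
            K s₀ * ‖siteToE (y - x)‖ ≤ depth (fun j => x j - R) (2 * R + 1) y →
              c₂ * Γ (‖siteToE (y - x)‖ * a β) ≤
                ‖siteToE (y - x)‖ ^ 8 *
                  kerCov (Matrix.specialUnitaryGroup (Fin 2) ℂ) (fundamentalLatticeRep 2) β (fun j => x j - R) (2 * R + 1) η (dens (Matrix.specialUnitaryGroup (Fin 2) ℂ) (fundamentalLatticeRep 2) x) (dens (Matrix.specialUnitaryGroup (Fin 2) ℂ) (fundamentalLatticeRep 2) y)) ∧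
        (∃ (v w : EuclideanSpace ℝ (Fin 4)) (σ δ : ℝ) (Γ₃ : ℝ → ℝ) (β₃ ℓ₃ c₃ : ℝ) (K₃ : ℝ → ℝ) (n₃ : ℕ),
      (σ = 1 ∨ σ = -1) ∧ 0 < δ ∧ 2 * δ < ‖v‖ ∧ 2 * δ < ‖w‖ ∧ 2 * δ < ‖v - w‖ ∧ 0 < ℓ₃ ∧ 0 < c₃ ∧
      (∀ s, 1 ≤ K₃ s) ∧ Tendsto (fun s : ℝ => s * K₃ s) (nhdsWithin 0 (Set.Ioi 0)) (nhds 0) ∧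
      Tendsto (fun s : ℝ => Γ₃ s / s ^ 4) (nhdsWithin 0 (Set.Ioi 0)) atTop ∧
      ∀ β : ℝ, β₃ ≤ β → ∀ (x : Fin 4 → ℤ) (R : ℕ), ((2 * R + 1 : ℕ) : ℝ) * a β ≤ ℓ₃ →
        ∀ (η : LGConfig 4 (Matrix.specialUnitaryGroup (Fin 2) ℂ)) (n : ℕ) (y z : Fin 4 → ℤ) (s₀ : ℝ), 0 < s₀ → s₀ ≤ (n : ℝ) * a β →
          n₃ ≤ n → ‖siteToE (y - x) - (n : ℝ) • v‖ ≤ δ * n → ‖siteToE (z - x) - (n : ℝ) • w‖ ≤ δ * n →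
            K₃ s₀ * n ≤ depth (fun j => x j - R) (2 * R + 1) x →
            K₃ s₀ * n ≤ depth (fun j => x j - R) (2 * R + 1) y →
            K₃ s₀ * n ≤ depth (fun j => x j - R) (2 * R + 1) z →
              c₃ * Γ₃ ((n : ℝ) * a β) ≤
                σ * (n : ℝ) ^ 12 * kerK3 (Matrix.specialUnitaryGroup (Fin 2) ℂ) (fundamentalLatticeRep 2) β (fun j => x j - R) (2 * R + 1) η x y z)) :
    letI : MeasurableSpace (Matrix.specialUnitaryGroup (Fin 2) ℂ) := borel _
    haveI : BorelSpace (Matrix.specialUnitaryGroup (Fin 2) ℂ) := ⟨rfl⟩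
    ∃ (a : ℝ → ℝ) (c₀ : ℝ), 0 < c₀ ∧ (∀ β, 0 < a β) ∧
      Tendsto (fun β => a β / Transport.uRec β) atTop (𝓝 c₀) ∧
      (∃ (v : 𝓢(EuclideanSpace ℝ (Fin 4), ℝ)) (ε β₅ Λ₅ : ℝ),
        HasCompactSupport (v : EuclideanSpace ℝ (Fin 4) → ℝ) ∧
        tsupport (v : EuclideanSpace ℝ (Fin 4) → ℝ) ⊆ {y : EuclideanSpace ℝ (Fin 4) | 0 < y 0} ∧ 0 < ε ∧
        ∀ β : ℝ, β₅ ≤ β → ∀ L : ℕ, Λ₅ ≤ a β * L →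
          ε ≤ Q2 (Matrix.specialUnitaryGroup (Fin 2) ℂ) (fundamentalLatticeRep 2) β L (a β) (thetaTest 4 v) v) ∧
      (∃ (f g h : 𝓢(EuclideanSpace ℝ (Fin 4), ℝ)) (ε β₅ Λ₅ : ℝ),
        HasCompactSupport (f : EuclideanSpace ℝ (Fin 4) → ℝ) ∧
        HasCompactSupport (g : EuclideanSpace ℝ (Fin 4) → ℝ) ∧
        HasCompactSupport (h : EuclideanSpace ℝ (Fin 4) → ℝ) ∧
        Disjoint (tsupport (f : EuclideanSpace ℝ (Fin 4) → ℝ)) (tsupport (g : EuclideanSpace ℝ (Fin 4) → ℝ)) ∧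
        Disjoint (tsupport (g : EuclideanSpace ℝ (Fin 4) → ℝ)) (tsupport (h : EuclideanSpace ℝ (Fin 4) → ℝ)) ∧
        Disjoint (tsupport (f : EuclideanSpace ℝ (Fin 4) → ℝ)) (tsupport (h : EuclideanSpace ℝ (Fin 4) → ℝ)) ∧
        0 < ε ∧ ∀ β : ℝ, β₅ ≤ β → ∀ L : ℕ, Λ₅ ≤ a β * L →
          ε ≤ |Q3 (Matrix.specialUnitaryGroup (Fin 2) ℂ) (fundamentalLatticeRep 2) β L (a β) f g h|) := by
  letI : MeasurableSpace (Matrix.specialUnitaryGroup (Fin 2) ℂ) := borel _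
  haveI : BorelSpace (Matrix.specialUnitaryGroup (Fin 2) ℂ) := ⟨rfl⟩
  obtain ⟨a, c₁, c₂, hc₁, hc₁₂, hapos, hwin, hFBL, hF, hT⟩ := h
  have hlim : Tendsto a atTop (𝓝 0) :=
    FloorsEngineOfWindow.tendsto_zero_of_window hapos UnitTransfer.uRec_pos UnitTransfer.tendsto_uRec
      (hwin.mono fun β hβ => hβ.2)
  exact floorsEngine_of_floor_commensurable (Matrix.specialUnitaryGroup (Fin 2) ℂ) (fundamentalLatticeRep 2) a
    hc₁ hc₁₂ hapos hlim hwin hFBL hF hT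

end Summit.QuantumFields.YangMills.Cruxes.UVSeamRec.WeakWindow

end
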